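import Mathlib
import HarnessLib
import Literature.Analysis.FluidPDE.LocalBiotSavartCalculus
import Summits.NavierStokesRegularity.NavierStokesRegularity.Theorems.HalfSpaceWindowDoorCirculationCarryingRigidityAngularFlux
import Summits.NavierStokesRegularity.NavierStokesRegularity.Theorems.AxisTwistDoorAveragedConeLiouvilleCircMonotone

/-!
# Route `HalfSpaceWindowDoor`, crux `CirculationCarryingRigidity` (stmt-NavierStokesRegularity-25311) —
# line `angular_flux` (LEAD ns-hsw-p1 g13): the REYNOLDS-STRESS LAW on axis circles —
# `R·S(R) = R·∮_{S(R)}ω₃ dl − 2Γ(R) − ∫₀ᴿ r (∂ₛΓ − Γ_zz + ∂_zP) dr`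

Integrating the conservative circle law of `…AngularFlux` (`∂ₛΓ = Γ_rr − r⁻¹Γ_r + Γ_zz − ∂ᵣS − r⁻¹S − ∂_zP`) against `r dr` over
`(0, R)` (the weight that makes `r(Γ_rr − r⁻¹Γ_r) = (rΓ_r − 2Γ)'` and `r(∂ᵣS + r⁻¹S) = (rS)'` exact derivatives) gives, for every
classical Navier–Stokes solution and every door-class profile, the identity (`radFlux_identity`, `radFlux_identity_of_class`)

  `R·S(R,z,s) = R·∮_{S(R,z)} ω₃ dl − 2Γ(R,z,s) − ∫₀ᴿ r·(∂ₛΓ − ∂_z²Γ + ∂_zP)(r,z,s) dr`,  `S = ∮v_r v_θ dl`, `P = ∮v₃ v_θ dl`.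

READING (card `Lines/angular_flux.md` §3).  On a closed-hemisphere profile `Γ ≥ 0`, `∮ω₃ dl ≥ 0`; beyond the flux tube `∮ω₃ dl` is
small, so the circle-integrated Reynolds stress is `S(R) ≈ −2Γ(R)/R` up to the unsteady/axial terms: a circulation-carrying plane
(`Γ(R) → Φ₀ > 0`) must be fed by INWARD angular-momentum flux of order `Φ₀/R` through every large circle unless
`∫₀ᴿ r(∂ₛΓ − Γ_zz + ∂_zP) dr ≈ −2Φ₀` — the quantitative form of «the enemy needs eddy spin-up» (for finite second moment
`M₂ = ∫|x_h|²ω₃`: `∫₀^∞ r(∂ₛ − ∂_z²)Γ dr = −½(∂ₛ − ∂_z²)M₂`).  Sign-free file; imports no route file.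

Seat ns-hsw-p1 g13, `--supports stmt-NavierStokesRegularity-25311 --as helper`.  WHAT THIS IS NOT: not about NS regularity; circle
bookkeeping for HYPOTHETICAL profiles; nothing is closed by this file.
-/

noncomputable section

-- the summit and its single sub-problem share the name (CONVENTIONS §1), as in every Theorems file
set_option linter.dupNamespace false

namespace Summit.NavierStokesRegularity.NavierStokesRegularity.Theorems.HalfSpaceWindowDoorCirculationCarryingRigidityAngularFluxStress

open scoped Topology InnerProductSpace RealInnerProductSpace
open Set Function MeasureTheory intervalIntegral Filter
open Literature.Analysis Literature.Analysis.FunctionSpaces Literature.Analysis.UnboundedOperators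
open Literature.Analysis.FluidPDE hiding eR
open Summit.NavierStokesRegularity.NavierStokesRegularity.Theorems.AxisTwistDoorAveragedConeLiouvilleDefs
  (cylPt eR eT e3 circ vortCirc radVortCirc)
open Summit.NavierStokesRegularity.NavierStokesRegularity.Theorems.AveragedConeLiouville.CircleStokes
  (continuous_eR continuous_eT contDiff_cylPt contDiff_eT deriv_circ_eq_vortCirc hasDerivAt_circ)
open Summit.NavierStokesRegularity.NavierStokesRegularity.Theorems.AxisTwistDoorAveragedConeLiouvilleCylFrame
  (continuous_cylPt_θ contDiff_cylPt_comp)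
open Summit.NavierStokesRegularity.NavierStokesRegularity.Theorems.AveragedConeLiouville.CircleCalculus
  (hasDerivAt_vortCirc_r hasDerivAt_radVortCirc_z deriv_circ_z contDiff_cylPt_z)
open Summit.NavierStokesRegularity.NavierStokesRegularity.Theorems.AveragedConeLiouville.CircleSwirl (hasDerivAt_circ_s)
open Summit.NavierStokesRegularity.NavierStokesRegularity.Theorems.AveragedConeLiouville.CircMonotone (circ_zero)
open Summit.NavierStokesRegularity.NavierStokesRegularity.Theorems
  (exists_isClassicalNSSolutionOn_Iio_of_isTypeIAncientMild)
open Summit.NavierStokesRegularity.NavierStokesRegularity.Theorems.PoloidalWindowDoorPoloidalWindowRigidityWindow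
  (isTypeIAncientMild_of_class)
open Summit.NavierStokesRegularity.NavierStokesRegularity.Theorems.HalfSpaceWindowDoorCirculationCarryingRigidityAngularFlux
  (circ_conservation_law hasDerivAt_radFlux hasDerivAt_axFlux)

variable {S : Set ℝ} {u : ℝ → EuclideanSpace ℝ (Fin 3) → EuclideanSpace ℝ (Fin 3)} {q : ℝ → EuclideanSpace ℝ (Fin 3) → ℝ}

/-- `(r, θ) ↦ cylPt r θ z` is continuous. -/
theorem continuous_cylPt_pair (z : ℝ) : Continuous fun p : ℝ × ℝ => cylPt p.1 p.2 z :=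
  (contDiff_cylPt z (n := 0)).continuous.comp (continuous_snd.prodMk continuous_fst)

/-- Continuity in `r` of a frame integral `∫₀^{2π} F(r, θ) dθ` with jointly continuous integrand. -/
theorem continuous_circleIntegral {F : ℝ → ℝ → ℝ} (hF : Continuous (uncurry F)) :
    Continuous fun r => ∫ θ in (0 : ℝ)..(2 * Real.pi), F r θ :=
  intervalIntegral.continuous_parametric_intervalIntegral_of_continuous' hF _ _

/-- **THE REYNOLDS-STRESS LAW ON AXIS CIRCLES** for a classical Navier–Stokes solution (unit viscosity, unforced) on an open
time set `S ∋ s`: for every `R ≥ 0` and height `z`,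
`R·S(R) = R·∮_{S(R,z)}ω₃ dl − 2Γ(R) − ∫₀ᴿ r(∂ₛΓ − ∂_z²Γ + ∂_zP)(r) dr`. -/
theorem radFlux_identity (hS : IsOpen S) (hcl : IsClassicalNSSolutionOn S 1 0 u q) {s : ℝ} (hs : s ∈ S) {R : ℝ}
    (hR : 0 ≤ R) (z : ℝ) :
    R * (∫ θ in (0 : ℝ)..(2 * Real.pi), ⟪u s (cylPt R θ z), eR θ⟫_ℝ * ⟪u s (cylPt R θ z), eT θ⟫_ℝ * R)
      = R * vortCirc u R z s - 2 * circ u R z s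
        - ∫ r in (0 : ℝ)..R, r * (deriv (fun s' => circ u r z s') s
            - deriv (fun z' => deriv (fun z'' => circ u r z'' s) z') z
            + deriv (fun z' => ∫ θ in (0 : ℝ)..(2 * Real.pi),
                ⟪u s (cylPt r θ z'), e3⟫_ℝ * ⟪u s (cylPt r θ z'), eT θ⟫_ℝ * r) z) := by
  have hC : ContDiff ℝ 2 (u s) := (hcl.contDiff_velocity hs).of_le (by norm_cast)
  have hC1 : ContDiff ℝ 1 (u s) := hC.of_le (by norm_cast)
  have hω : ContDiff ℝ 1 (curl (u s)) := contDiff_curl (n := 1) (by exact_mod_cast hC)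
  have hq1 : ContDiff ℝ 1 (q s) := (hcl.contDiff_pressure hs).of_le (by norm_cast)
  -- continuity of the basic fields
  have huc : Continuous (u s) := hC1.continuous
  have hDc : Continuous (fderiv ℝ (u s)) := hC1.continuous_fderiv one_ne_zero
  have hωc : Continuous (curl (u s)) := hω.continuous
  have hDωc : Continuous (fderiv ℝ (curl (u s))) := hω.continuous_fderiv one_ne_zero
  have hcyl := continuous_cylPt_pair z
  -- abbreviations (as functions of `r`)
  set Srad : ℝ → ℝ := fun r => ∫ θ in (0 : ℝ)..(2 * Real.pi), ⟪u s (cylPt r θ z), eR θ⟫_ℝ * ⟪u s (cylPt r θ z), eT θ⟫_ℝ * r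
    with hSrad
  set dS : ℝ → ℝ := fun r => ∫ θ in (0 : ℝ)..(2 * Real.pi),
      (⟪fderiv ℝ (u s) (cylPt r θ z) (eR θ), eR θ⟫_ℝ * ⟪u s (cylPt r θ z), eT θ⟫_ℝ * r
        + ⟪u s (cylPt r θ z), eR θ⟫_ℝ * ⟪fderiv ℝ (u s) (cylPt r θ z) (eR θ), eT θ⟫_ℝ * r
        + ⟪u s (cylPt r θ z), eR θ⟫_ℝ * ⟪u s (cylPt r θ z), eT θ⟫_ℝ) with hdS
  set dV : ℝ → ℝ := fun r => ∫ θ in (0 : ℝ)..(2 * Real.pi),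
      (⟪fderiv ℝ (curl (u s)) (cylPt r θ z) (eR θ), e3⟫_ℝ * r + ⟪curl (u s) (cylPt r θ z), e3⟫_ℝ) with hdV
  set dP : ℝ → ℝ := fun r => ∫ θ in (0 : ℝ)..(2 * Real.pi),
      (⟪fderiv ℝ (u s) (cylPt r θ z) e3, e3⟫_ℝ * ⟪u s (cylPt r θ z), eT θ⟫_ℝ
        + ⟪u s (cylPt r θ z), e3⟫_ℝ * ⟪fderiv ℝ (u s) (cylPt r θ z) e3, eT θ⟫_ℝ) * r with hdP
  set dZZ : ℝ → ℝ := fun r => -(∫ θ in (0 : ℝ)..(2 * Real.pi),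
      ⟪fderiv ℝ (curl (u s)) (cylPt r θ z) e3, eR θ⟫_ℝ * r) with hdZZ
  -- the time derivative through the momentum equation: `∂ₛu = −curl curl u − ∇q − (u·∇)u`
  set M : EuclideanSpace ℝ (Fin 3) → EuclideanSpace ℝ (Fin 3) :=
    fun x => -curl (curl (u s)) x - gradient (q s) x - fderiv ℝ (u s) x (u s x) with hM
  have hmom : ∀ x, deriv (fun τ => u τ x) s = M x := fun x => by
    have h := hcl.momentum s hs x
    rw [timeDerivWithin_eq_deriv hS hs, one_smul, laplacian_eq_neg_curl_curl hC (hcl.divFree s hs)] at h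
    simp only [convect, Pi.zero_apply, add_zero] at h
    rw [hM]
    exact eq_sub_of_add_eq h
  have hMc : Continuous M := by
    have hgc : Continuous (gradient (q s)) :=
      (InnerProductSpace.toDual ℝ (EuclideanSpace ℝ (Fin 3))).symm.continuous.comp (hq1.continuous_fderiv one_ne_zero)
    exact (((continuous_curl hω).neg).sub hgc).sub (hDc.clm_apply huc)
  set dT : ℝ → ℝ := fun r => ∫ θ in (0 : ℝ)..(2 * Real.pi), ⟪M (cylPt r θ z), eT θ⟫_ℝ * r with hdT
  -- identification of the `deriv` terms with the closed forms, for every `r`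
  have hT : ∀ r, deriv (fun s' => circ u r z s') s = dT r := fun r => by
    rw [(hasDerivAt_circ_s hS hcl.smooth_velocity hs r z).deriv, hdT]
    exact intervalIntegral.integral_congr fun θ _ => by simp only [hmom]
  have hZZ : ∀ r, deriv (fun z' => deriv (fun z'' => circ u r z'' s) z') z = dZZ r := fun r => by
    rw [show (fun z' => deriv (fun z'' => circ u r z'' s) z') = fun z' => -radVortCirc u r z' s from
      funext fun z' => deriv_circ_z u hC1 r z']
    have h' : HasDerivAt (fun z' => -radVortCirc u r z' s)
        (-(∫ θ in (0 : ℝ)..(2 * Real.pi), ⟪fderiv ℝ (curl (u s)) (cylPt r θ z) e3, eR θ⟫_ℝ * r)) z :=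
      (hasDerivAt_radVortCirc_z u hC r z).neg
    exact h'.deriv
  have hP : ∀ r, deriv (fun z' => ∫ θ in (0 : ℝ)..(2 * Real.pi),
      ⟪u s (cylPt r θ z'), e3⟫_ℝ * ⟪u s (cylPt r θ z'), eT θ⟫_ℝ * r) z = dP r := fun r =>
    (hasDerivAt_axFlux hC1 r z).deriv
  have hV : ∀ r, deriv (fun r' => vortCirc u r' z s) r = dV r := fun r => (hasDerivAt_vortCirc_r u hC r z).deriv
  -- continuity of the closed forms
  have hdTc : Continuous dT := continuous_circleIntegral
    (((hMc.comp hcyl).inner (continuous_eT.comp continuous_snd)).mul continuous_fst)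
  have hdZZc : Continuous dZZ := by
    have h : Continuous (uncurry fun r θ => ⟪fderiv ℝ (curl (u s)) (cylPt r θ z) e3, eR θ⟫_ℝ * r) :=
      (((hDωc.comp hcyl).clm_apply (continuous_const (y := e3))).inner (continuous_eR.comp continuous_snd)).mul
        continuous_fst
    exact (continuous_circleIntegral h).neg
  have hdPc : Continuous dP := by
    have h : Continuous (uncurry fun r θ =>
        (⟪fderiv ℝ (u s) (cylPt r θ z) e3, e3⟫_ℝ * ⟪u s (cylPt r θ z), eT θ⟫_ℝ
          + ⟪u s (cylPt r θ z), e3⟫_ℝ * ⟪fderiv ℝ (u s) (cylPt r θ z) e3, eT θ⟫_ℝ) * r) :=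
      (((((hDc.comp hcyl).clm_apply (continuous_const (y := e3))).inner (continuous_const (y := e3))).mul
          ((huc.comp hcyl).inner (continuous_eT.comp continuous_snd))).add
        (((huc.comp hcyl).inner (continuous_const (y := e3))).mul
          (((hDc.comp hcyl).clm_apply (continuous_const (y := e3))).inner (continuous_eT.comp continuous_snd)))).mul
        continuous_fst
    exact continuous_circleIntegral h
  have hSc : Continuous Srad := continuous_circleIntegral
    ((((huc.comp hcyl).inner (continuous_eR.comp continuous_snd)).mul
      ((huc.comp hcyl).inner (continuous_eT.comp continuous_snd))).mul continuous_fst)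
  have hVc : Continuous fun r => vortCirc u r z s :=
    Summit.NavierStokesRegularity.NavierStokesRegularity.Theorems.AveragedConeLiouville.CircMonotone.continuous_vortCirc u hC1 z
  have hΓc : Continuous fun r => circ u r z s :=
    (Summit.NavierStokesRegularity.NavierStokesRegularity.Theorems.AveragedConeLiouville.CircleStokes.differentiable_circ u hC1 z).continuous
  -- the integrand in closed form, and its integrability
  have hg_eq : (fun r => r * (deriv (fun s' => circ u r z s') s
      - deriv (fun z' => deriv (fun z'' => circ u r z'' s) z') z
      + deriv (fun z' => ∫ θ in (0 : ℝ)..(2 * Real.pi),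
          ⟪u s (cylPt r θ z'), e3⟫_ℝ * ⟪u s (cylPt r θ z'), eT θ⟫_ℝ * r) z))
      = fun r => r * (dT r - dZZ r + dP r) := funext fun r => by rw [hT, hZZ, hP]
  rw [hg_eq]
  -- the primitive `f(r) = r·vortCirc − 2Γ − r·S` and its derivative on `(0, R)`
  have hderiv : ∀ r ∈ Ioo 0 R, HasDerivAt (fun r' => r' * vortCirc u r' z s - 2 * circ u r' z s - r' * Srad r')
      (r * (dT r - dZZ r + dP r)) r := by
    intro r hr
    have hr0 : r ≠ 0 := hr.1.ne'
    have h1 : HasDerivAt (fun r' => r' * vortCirc u r' z s) (1 * vortCirc u r z s + r * dV r) r :=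
      ((hasDerivAt_id r).mul (hasDerivAt_vortCirc_r u hC r z)).congr_of_eventuallyEq (Eventually.of_forall fun _ => rfl)
    have h2 : HasDerivAt (fun r' => 2 * circ u r' z s) (2 * vortCirc u r z s) r := (hasDerivAt_circ u hC1 r z).const_mul 2
    have h3 : HasDerivAt (fun r' => r' * Srad r') (1 * Srad r + r * dS r) r :=
      ((hasDerivAt_id r).mul (hasDerivAt_radFlux hC1 r z)).congr_of_eventuallyEq (Eventually.of_forall fun _ => rfl)
    have h := (h1.sub h2).sub h3
    refine (h.congr_of_eventuallyEq (Eventually.of_forall fun _ => rfl)).congr_deriv ?_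
    -- the conservative law at `r ≠ 0`
    have hlaw := circ_conservation_law hS hcl hs hr0 z
    rw [hT, hZZ, hP, deriv_circ_eq_vortCirc u hC1 r z,
      show (fun r' => deriv (fun r'' => circ u r'' z s) r') = fun r' => vortCirc u r' z s from
        funext fun r' => deriv_circ_eq_vortCirc u hC1 r' z, hV, (hasDerivAt_radFlux hC1 r z).deriv] at hlaw
    have : dT r = dV r - r⁻¹ * vortCirc u r z s + dZZ r - (dS r + r⁻¹ * Srad r + dP r) := by
      rw [hlaw]
    rw [this]
    field_simp
    ring
  have hcont : ContinuousOn (fun r' => r' * vortCirc u r' z s - 2 * circ u r' z s - r' * Srad r') (Icc 0 R) :=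
    (((continuous_id.mul hVc).sub (continuous_const.mul hΓc)).sub (continuous_id.mul hSc)).continuousOn
  have hint : IntervalIntegrable (fun r => r * (dT r - dZZ r + dP r)) volume 0 R :=
    ((continuous_id.mul ((hdTc.sub hdZZc).add hdPc)).intervalIntegrable _ _)
  rw [integral_eq_sub_of_hasDerivAt_of_le hR hcont hderiv hint]
  simp only [circ_zero, zero_mul, mul_zero, sub_zero]
  ring

/-- **THE REYNOLDS-STRESS LAW in the door class** (Type-I time rate, continuity on the open lower slab, unit-viscosity
Oseen–Duhamel identity, divergence-free slices — the four fields of `…Defs.InDoorClass`, spelled out): for every `s < 0`,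
`R ≥ 0`, `z`: `R·S(R) = R·∮_{S(R,z)}ω₃ dl − 2Γ(R) − ∫₀ᴿ r(∂ₛΓ − ∂_z²Γ + ∂_zP) dr`.  On the closed hemisphere `Γ ≥ 0` and
`∮ω₃ dl ≥ 0` (AxisTwistDoor `…CircMonotone`), so a circulation-carrying plane needs inward angular-momentum flux `≍ −2Γ(R)/R`
through its large circles unless the unsteady/axial integral compensates (card §3). -/
theorem radFlux_identity_of_class {v : ℝ → EuclideanSpace ℝ (Fin 3) → EuclideanSpace ℝ (Fin 3)} {C : ℝ}
    (hrate : HasTypeITimeDecay C v) (hcont : ContinuousOn (uncurry v) (Iio (0 : ℝ) ×ˢ univ))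
    (hmild : ∀ s t : ℝ, s < t → t < 0 → ∀ x, v t x = heatExtension (v s) (t - s) x - oseenDuhamel 1 s v v t x)
    (hdiv : ∀ t < 0, VectorCalculus.IsDivFree (v t)) {s : ℝ} (hs : s < 0) {R : ℝ} (hR : 0 ≤ R) (z : ℝ) :
    R * (∫ θ in (0 : ℝ)..(2 * Real.pi), ⟪v s (cylPt R θ z), eR θ⟫_ℝ * ⟪v s (cylPt R θ z), eT θ⟫_ℝ * R)
      = R * vortCirc v R z s - 2 * circ v R z s
        - ∫ r in (0 : ℝ)..R, r * (deriv (fun s' => circ v r z s') s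
            - deriv (fun z' => deriv (fun z'' => circ v r z'' s) z') z
            + deriv (fun z' => ∫ θ in (0 : ℝ)..(2 * Real.pi),
                ⟪v s (cylPt r θ z'), e3⟫_ℝ * ⟪v s (cylPt r θ z'), eT θ⟫_ℝ * r) z) := by
  obtain ⟨p, hcl⟩ := exists_isClassicalNSSolutionOn_Iio_of_isTypeIAncientMild
    (isTypeIAncientMild_of_class hrate hcont hmild hdiv)
  exact radFlux_identity isOpen_Iio hcl hs hR z

end Summit.NavierStokesRegularity.NavierStokesRegularity.Theorems.HalfSpaceWindowDoorCirculationCarryingRigidityAngularFluxStress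

end
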